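/-
Copyright (c) 2026 the pub-hodgecm-mathlib formalisation cell (harness21).  Prover seat hodgecm-mathlib-K2Liu-p13 (g4), Track B «K2-LIT»,
#184♮ = hLiu418 = `stmt-HodgeConjecture-24832`; ROAD Φ (RULING «M-156n»), #41 TOP edition 5 «ASSEMBLED» — the KIND-0 big-cell scalar `a = b^S∕a^S` under a CHANGE OF
THE EXCEPTIONAL SET `S ⊆ T = S ∪ P` (finding (F1) of census 065e2d080ef468d9: the TOP's scalar must be taken at `S = S_ε`, the Euler head ★ Φ3d factorises off a
larger `T ⊇ S_ε` containing the ramification of the section — the two differ by the FINITE product of the local Gindikin–Karpelevich scalars over `T ∖ S`).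
THEOREMS ONLY (no `def`, no `instance`, no named-fact hypothesis, no `sorry`).
-/
import Summits.HodgeConjecture.HodgeConjecture.Theorems.K2LiuSiegelIntertwiningScalarGL1   -- ★ O41.6 `hasProd_a`, `hasProd_b`, `hasProd_localScalar`, `_cm`
import HarnessLib

/-!
# Crux `HLiu418`, ROAD Φ, organ Φ8 (row G6): THE SIEGEL INTERTWINING SCALAR UNDER A CHANGE OF THE EXCEPTIONAL SET — `a^S = (∏_{v∈P} a_v)·a^{S∪P}`,
# `b^S = (∏_{v∈P} b_v)·b^{S∪P}`, `b^S∕a^S = (∏_{v∈P} c_v⁻¹)·(b^{S∪P}∕a^{S∪P})`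

Cell `hodgecm-mathlib`, crux item hLiu418 = `stmt-HodgeConjecture-24832` (helper lane, count-neutral).  Number field `F`, unitary Hecke character `ε`
(`χ⁰ = ε_{L∕L⁺}` at the K2_Liu frame), `S` any set of finite places, `P` a FINITE set of finite places disjoint from `S`, `T = S ∪ P`.
★ O41.6 (`K2LiuSiegelIntertwiningScalarGL1`) gives the Euler products `a^S(s) = ζ_F^S(2s)L^S(2s−1,ε) = ∏'_{v∉S} a_v(s)` (`re s > 1`), `b^S(s) = ζ_F^S(2s+1)L^S(2s+2,ε) = ∏'_{v∉S} b_v(s)`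
(`re s > 0`) and `∏'_{v∉S} c_v(s) = a^S∕b^S` with the LOCAL Gindikin–Karpelevich scalar `c_v = a_v∕b_v = [(1−q_v^{−(2s+1)})(1−ε_v q_v^{−(2s+2)})]∕[(1−q_v^{−2s})(1−ε_v q_v^{−(2s−1)})]`.
THIS FILE moves the exceptional set:
* §1 **`hasProd_of_hasProd_off_union_finset`** — generic: an Euler product off `S ∪ P` (`P` finite, disjoint from `S`) converging to `b` gives the Euler product off `S`
  converging to `(∏_{v∈P} f v) · b` (Mathlib `HasProd.mul_compl` + `Finset.hasProd` on the index type `{v ∉ S}`).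
* §2 **`a_eq_finsetProd_mul`**, **`b_eq_finsetProd_mul`** (`HasProd.unique` against ★ `hasProd_a`∕`hasProd_b` at `S` and at `S ∪ P`), and the quotients
  **`scalar_eq_finsetProd_mul`**: `a^S∕b^S = (∏_{v∈P} c_v)·(a^{S∪P}∕b^{S∪P})` and **`invScalar_eq_finsetProd_mul`**: `b^S∕a^S = (∏_{v∈P} c_v⁻¹)·(b^{S∪P}∕a^{S∪P})` on `re s > 1`.
* §3 **`differentiableOn_inv_localScalar`** — `s ↦ c_v(s)⁻¹` is holomorphic on `{−½ < re}` (its denominator `(1−q_v^{−(2s+1)})(1−ε_v q_v^{−(2s+2)})` does not vanish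
  there), hence so is `∏_{v∈P} c_v⁻¹`.
* §4 the CM corollaries `…_cm` (`ε = ε_{L∕L⁺} =` ★ `quadraticHeckeCharCM L`, `F = L⁺`; unitary by ★ `isFiniteOrder_quadraticHeckeCharCM`).
HOW (β) USES IT.  With the TOP's scalar `a := b^{S_ε}∕a^{S_ε}` (★ `exists_bigCell_termPackage_cm`, `S_ε` = ramification of `ε`) and the Euler head ★ Φ3d at `T = S_ε ∪ P ⊇`
ramification of `f`: `a(s)·M(s)f_s(κ) = (∏_{v∈P} c_v(s)⁻¹)·(b^T∕a^T)(s)·M(s)f_s(κ)`, and `c_v⁻¹` cancels the pole-carrying scalar `aNorm_v = vol_v·c_v` of ★ A7-AllS0 at the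
`ε`-unramified bad places `v ∈ P` — leaving `vol_v·Fn_v`, holomorphic on `{0 < re}` (★∕📤 `K2LiuBigCellContinuationPointLetters`).
Sources: [Tan1999, §3]; [Harris2007, (1.3.4) p. 92]; [KudlaSweet1997, §1]; [HarrisKudlaSweet1996, §6 (6.14)–(6.16)]; [HeilbronnZetaL1967, Ch. VIII §2 Thm. 5].
HONEST LABEL.  Helper lemmas, count-neutral; `HC_CM` is proved only modulo the 7 printed citations (2 remaining named inputs:
hLiu418 = `stmt-HodgeConjecture-24832`, h413 = `stmt-HodgeConjecture-24833`) until rung 0 closes.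
-/

set_option autoImplicit false
set_option linter.dupNamespace false -- the mandated namespace repeats `HodgeConjecture.HodgeConjecture`

noncomputable section

open scoped NNReal
open Filter Topology Complex NumberField IsDedekindDomain
open Literature.NumberTheory.Automorphic Literature.NumberTheory.LFunctions Literature.NumberTheory.GaloisRepresentations

namespace Summit.HodgeConjecture.HodgeConjecture.Cruxes.HLiu418.K2LiuSiegelIntertwiningScalarChangeOfSet

open Summit.HodgeConjecture.HodgeConjecture.Cruxes.HLiu418.K2LiuSiegelIntertwiningScalarGL1

/-! ## §1 Generic: moving finitely many places into the exceptional set of a convergent Euler product -/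

/-- **An Euler product off `S ∪ P` gives the Euler product off `S`, times the finite product over `P`** (`P` finite, disjoint from `S`):
`HasProd (v ∉ S ∪ P ↦ f v) b → HasProd (v ∉ S ↦ f v) ((∏_{v∈P} f v) · b)`. [cite: HeilbronnZetaL1967, Ch. VIII §2 Thm. 5] -/
theorem hasProd_of_hasProd_off_union_finset {β : Type*} (S : Set β) (P : Finset β) (hPS : ∀ v ∈ P, v ∉ S) (f : β → ℂ) {b : ℂ}
    (hb : HasProd (fun v : {v : β // v ∉ S ∪ (↑P : Set β)} => f v.1) b) :
    HasProd (fun v : {v : β // v ∉ S} => f v.1) ((∏ v ∈ P, f v) * b) := by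
  classical
  set s₀ : Set {v : β // v ∉ S} := ↑(P.subtype fun v => v ∉ S) with hs₀
  have hmem : ∀ x : {v : β // v ∉ S}, x ∈ s₀ ↔ x.1 ∈ P := fun x => by
    rw [hs₀, Finset.mem_coe, Finset.mem_subtype]
  -- the finite part
  have ha : HasProd ((fun x : {v : β // v ∉ S} => f x.1) ∘ (↑) : s₀ → ℂ) (∏ v ∈ P, f v) := by
    have h1 := Finset.hasProd (P.subtype fun v => v ∉ S) (fun x : {v : β // v ∉ S} => f x.1)
    rwa [Finset.prod_subtype_of_mem (fun v => f v) hPS] at h1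
  -- the cofinite part, along `↥(s₀ᶜ) ≃ {v ∉ S ∪ P}`
  let e₂ : ↥(s₀ᶜ) ≃ {v : β // v ∉ S ∪ (↑P : Set β)} :=
    { toFun := fun x => ⟨x.1.1, by
        rintro (h | h)
        · exact x.1.2 h
        · exact x.2 ((hmem x.1).2 (Finset.mem_coe.1 h))⟩
      invFun := fun v => ⟨⟨v.1, fun h => v.2 (Or.inl h)⟩, fun h => v.2 (Or.inr (Finset.mem_coe.2 ((hmem _).1 h)))⟩
      left_inv := fun x => rfl
      right_inv := fun v => rfl }
  have hb' : HasProd ((fun x : {v : β // v ∉ S} => f x.1) ∘ (↑) : ↥(s₀ᶜ) → ℂ) b :=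
    (e₂.hasProd_iff (f := fun v : {v : β // v ∉ S ∪ (↑P : Set β)} => f v.1)).2 hb
  exact ha.mul_compl hb'

/-- the `tprod` form: `∏'_{v∉S} f v = (∏_{v∈P} f v) · ∏'_{v∉S∪P} f v` when the product off `S ∪ P` converges. [cite: HeilbronnZetaL1967, Ch. VIII §2 Thm. 5] -/
theorem tprod_eq_finsetProd_mul_tprod {β : Type*} (S : Set β) (P : Finset β) (hPS : ∀ v ∈ P, v ∉ S) (f : β → ℂ)
    (hb : Multipliable fun v : {v : β // v ∉ S ∪ (↑P : Set β)} => f v.1) :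
    ∏' v : {v : β // v ∉ S}, f v.1 = (∏ v ∈ P, f v) * ∏' v : {v : β // v ∉ S ∪ (↑P : Set β)}, f v.1 :=
  (hasProd_of_hasProd_off_union_finset S P hPS f hb.hasProd).tprod_eq

/-! ## §2 `a^S`, `b^S` and `a^S∕b^S` under `S ↦ S ∪ P` -/

section GL1

variable {F : Type} [Field F] [NumberField F] {ε : HeckeCharacter F}

/-- **`a^S(s) = (∏_{v∈P} a_v(s)) · a^{S∪P}(s)`** on `re s > 1`, `a_v(s) = (1−q_v^{−2s})⁻¹(1−ε_v q_v^{−(2s−1)})⁻¹`. [cite: Tan1999, §3] [cite: Harris2007, (1.3.4) p. 92] -/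
theorem a_eq_finsetProd_mul (hε : ε.IsUnitary) (S : Set (HeightOneSpectrum (𝓞 F))) (P : Finset (HeightOneSpectrum (𝓞 F)))
    (hPS : ∀ v ∈ P, v ∉ S) {s : ℂ} (hs : 1 < s.re) :
    partialStandardL S (fun _ => {1}) (2 * s) * partialStandardL S (fun v => {ε.valueAtUniformizer v}) (2 * s - 1) =
      (∏ v ∈ P, ((1 - (v.residueCard : ℂ) ^ (-(2 * s)))⁻¹ * (1 - ε.valueAtUniformizer v * (v.residueCard : ℂ) ^ (-(2 * s - 1)))⁻¹)) *
        (partialStandardL (S ∪ (↑P : Set (HeightOneSpectrum (𝓞 F)))) (fun _ => {1}) (2 * s) *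
          partialStandardL (S ∪ (↑P : Set (HeightOneSpectrum (𝓞 F)))) (fun v => {ε.valueAtUniformizer v}) (2 * s - 1)) :=
  (hasProd_a (S := S) hε hs).1.unique
    (hasProd_of_hasProd_off_union_finset S P hPS
      (fun v => (1 - (v.residueCard : ℂ) ^ (-(2 * s)))⁻¹ * (1 - ε.valueAtUniformizer v * (v.residueCard : ℂ) ^ (-(2 * s - 1)))⁻¹)
      (hasProd_a (S := S ∪ (↑P : Set (HeightOneSpectrum (𝓞 F)))) hε hs).1)

/-- **`b^S(s) = (∏_{v∈P} b_v(s)) · b^{S∪P}(s)`** on `re s > 0`, `b_v(s) = (1−q_v^{−(2s+1)})⁻¹(1−ε_v q_v^{−(2s+2)})⁻¹`. [cite: Tan1999, §3] [cite: Harris2007, (1.3.4) p. 92] -/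
theorem b_eq_finsetProd_mul (hε : ε.IsUnitary) (S : Set (HeightOneSpectrum (𝓞 F))) (P : Finset (HeightOneSpectrum (𝓞 F)))
    (hPS : ∀ v ∈ P, v ∉ S) {s : ℂ} (hs : 0 < s.re) :
    partialStandardL S (fun _ => {1}) (2 * s + 1) * partialStandardL S (fun v => {ε.valueAtUniformizer v}) (2 * s + 2) =
      (∏ v ∈ P, ((1 - (v.residueCard : ℂ) ^ (-(2 * s + 1)))⁻¹ * (1 - ε.valueAtUniformizer v * (v.residueCard : ℂ) ^ (-(2 * s + 2)))⁻¹)) *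
        (partialStandardL (S ∪ (↑P : Set (HeightOneSpectrum (𝓞 F)))) (fun _ => {1}) (2 * s + 1) *
          partialStandardL (S ∪ (↑P : Set (HeightOneSpectrum (𝓞 F)))) (fun v => {ε.valueAtUniformizer v}) (2 * s + 2)) :=
  (hasProd_b (S := S) hε hs).1.unique
    (hasProd_of_hasProd_off_union_finset S P hPS
      (fun v => (1 - (v.residueCard : ℂ) ^ (-(2 * s + 1)))⁻¹ * (1 - ε.valueAtUniformizer v * (v.residueCard : ℂ) ^ (-(2 * s + 2)))⁻¹)
      (hasProd_b (S := S ∪ (↑P : Set (HeightOneSpectrum (𝓞 F)))) hε hs).1)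

/-- per place: `a_v∕b_v = c_v` in ★ `hasProd_localScalar`'s spelling (`(x⁻¹y⁻¹)∕(u⁻¹w⁻¹) = (uw)∕(xy)`, unconditionally in a field). [cite: Harris2007, (1.3.4) p. 92] -/
theorem localA_div_localB_eq (q e : ℂ) (s : ℂ) :
    ((1 - q ^ (-(2 * s)))⁻¹ * (1 - e * q ^ (-(2 * s - 1)))⁻¹) / ((1 - q ^ (-(2 * s + 1)))⁻¹ * (1 - e * q ^ (-(2 * s + 2)))⁻¹) =
      ((1 - q ^ (-(2 * s + 1))) * (1 - e * q ^ (-(2 * s + 2)))) / ((1 - q ^ (-(2 * s))) * (1 - e * q ^ (-(2 * s - 1)))) := by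
  simp only [div_eq_mul_inv, mul_inv, inv_inv]
  ring

/-- **`a^S∕b^S = (∏_{v∈P} c_v) · (a^{S∪P}∕b^{S∪P})`** on `re s > 1`, with `c_v(s) = [(1−q_v^{−(2s+1)})(1−ε_v q_v^{−(2s+2)})]∕[(1−q_v^{−2s})(1−ε_v q_v^{−(2s−1)})]` the local
Gindikin–Karpelevich scalar of ★ `hasProd_localScalar`. [cite: Tan1999, §3] [cite: Harris2007, (1.3.4) p. 92] [cite: KudlaSweet1997, §1] -/
theorem scalar_eq_finsetProd_mul (hε : ε.IsUnitary) (S : Set (HeightOneSpectrum (𝓞 F))) (P : Finset (HeightOneSpectrum (𝓞 F)))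
    (hPS : ∀ v ∈ P, v ∉ S) {s : ℂ} (hs : 1 < s.re) :
    (partialStandardL S (fun _ => {1}) (2 * s) * partialStandardL S (fun v => {ε.valueAtUniformizer v}) (2 * s - 1)) /
        (partialStandardL S (fun _ => {1}) (2 * s + 1) * partialStandardL S (fun v => {ε.valueAtUniformizer v}) (2 * s + 2)) =
      (∏ v ∈ P, (((1 - (v.residueCard : ℂ) ^ (-(2 * s + 1))) * (1 - ε.valueAtUniformizer v * (v.residueCard : ℂ) ^ (-(2 * s + 2)))) /
          ((1 - (v.residueCard : ℂ) ^ (-(2 * s))) * (1 - ε.valueAtUniformizer v * (v.residueCard : ℂ) ^ (-(2 * s - 1)))))) *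
        ((partialStandardL (S ∪ (↑P : Set (HeightOneSpectrum (𝓞 F)))) (fun _ => {1}) (2 * s) *
            partialStandardL (S ∪ (↑P : Set (HeightOneSpectrum (𝓞 F)))) (fun v => {ε.valueAtUniformizer v}) (2 * s - 1)) /
          (partialStandardL (S ∪ (↑P : Set (HeightOneSpectrum (𝓞 F)))) (fun _ => {1}) (2 * s + 1) *
            partialStandardL (S ∪ (↑P : Set (HeightOneSpectrum (𝓞 F)))) (fun v => {ε.valueAtUniformizer v}) (2 * s + 2))) := by
  rw [a_eq_finsetProd_mul hε S P hPS hs, b_eq_finsetProd_mul hε S P hPS (zero_lt_one.trans hs), mul_div_mul_comm, ← Finset.prod_div_distrib]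
  refine congrArg₂ (· * ·) (Finset.prod_congr rfl fun v _ => localA_div_localB_eq _ _ s) rfl

/-- **`b^S∕a^S = (∏_{v∈P} c_v⁻¹) · (b^{S∪P}∕a^{S∪P})`** on `re s > 1` — the TOP's scalar `a = b^S∕a^S` (★ `exists_bigCell_termPackage_cm`) moved to the larger exceptional set of
the Euler head. [cite: Tan1999, §3] [cite: Harris2007, (1.3.4) p. 92] [cite: KudlaSweet1997, §1] -/
theorem invScalar_eq_finsetProd_mul (hε : ε.IsUnitary) (S : Set (HeightOneSpectrum (𝓞 F))) (P : Finset (HeightOneSpectrum (𝓞 F)))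
    (hPS : ∀ v ∈ P, v ∉ S) {s : ℂ} (hs : 1 < s.re) :
    (partialStandardL S (fun _ => {1}) (2 * s + 1) * partialStandardL S (fun v => {ε.valueAtUniformizer v}) (2 * s + 2)) /
        (partialStandardL S (fun _ => {1}) (2 * s) * partialStandardL S (fun v => {ε.valueAtUniformizer v}) (2 * s - 1)) =
      (∏ v ∈ P, (((1 - (v.residueCard : ℂ) ^ (-(2 * s))) * (1 - ε.valueAtUniformizer v * (v.residueCard : ℂ) ^ (-(2 * s - 1)))) /
          ((1 - (v.residueCard : ℂ) ^ (-(2 * s + 1))) * (1 - ε.valueAtUniformizer v * (v.residueCard : ℂ) ^ (-(2 * s + 2)))))) *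
        ((partialStandardL (S ∪ (↑P : Set (HeightOneSpectrum (𝓞 F)))) (fun _ => {1}) (2 * s + 1) *
            partialStandardL (S ∪ (↑P : Set (HeightOneSpectrum (𝓞 F)))) (fun v => {ε.valueAtUniformizer v}) (2 * s + 2)) /
          (partialStandardL (S ∪ (↑P : Set (HeightOneSpectrum (𝓞 F)))) (fun _ => {1}) (2 * s) *
            partialStandardL (S ∪ (↑P : Set (HeightOneSpectrum (𝓞 F)))) (fun v => {ε.valueAtUniformizer v}) (2 * s - 1))) := by
  rw [← inv_div, scalar_eq_finsetProd_mul hε S P hPS hs, mul_inv, inv_div, ← Finset.prod_inv_distrib]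
  refine congrArg₂ (· * ·) (Finset.prod_congr rfl fun v _ => inv_div _ _) rfl

/-- the same as a product identity free of division by the `S`-side: **`(b^S∕a^S)·(a^{S∪P}∕b^{S∪P}) = ∏_{v∈P} c_v⁻¹`** on `re s > 1` (`a^{S∪P}, b^{S∪P} ≠ 0` there).
[cite: Tan1999, §3] [cite: KudlaSweet1997, §1] -/
theorem invScalar_mul_scalar_union_eq_finsetProd (hε : ε.IsUnitary) (S : Set (HeightOneSpectrum (𝓞 F))) (P : Finset (HeightOneSpectrum (𝓞 F)))
    (hPS : ∀ v ∈ P, v ∉ S) {s : ℂ} (hs : 1 < s.re) :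
    (partialStandardL S (fun _ => {1}) (2 * s + 1) * partialStandardL S (fun v => {ε.valueAtUniformizer v}) (2 * s + 2)) /
          (partialStandardL S (fun _ => {1}) (2 * s) * partialStandardL S (fun v => {ε.valueAtUniformizer v}) (2 * s - 1)) *
        ((partialStandardL (S ∪ (↑P : Set (HeightOneSpectrum (𝓞 F)))) (fun _ => {1}) (2 * s) *
            partialStandardL (S ∪ (↑P : Set (HeightOneSpectrum (𝓞 F)))) (fun v => {ε.valueAtUniformizer v}) (2 * s - 1)) /
          (partialStandardL (S ∪ (↑P : Set (HeightOneSpectrum (𝓞 F)))) (fun _ => {1}) (2 * s + 1) *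
            partialStandardL (S ∪ (↑P : Set (HeightOneSpectrum (𝓞 F)))) (fun v => {ε.valueAtUniformizer v}) (2 * s + 2))) =
      ∏ v ∈ P, (((1 - (v.residueCard : ℂ) ^ (-(2 * s))) * (1 - ε.valueAtUniformizer v * (v.residueCard : ℂ) ^ (-(2 * s - 1)))) /
          ((1 - (v.residueCard : ℂ) ^ (-(2 * s + 1))) * (1 - ε.valueAtUniformizer v * (v.residueCard : ℂ) ^ (-(2 * s + 2))))) := by
  have ha := (hasProd_a (S := S ∪ (↑P : Set (HeightOneSpectrum (𝓞 F)))) hε hs).2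
  have hb := (hasProd_b (S := S ∪ (↑P : Set (HeightOneSpectrum (𝓞 F)))) hε (zero_lt_one.trans hs)).2
  rw [invScalar_eq_finsetProd_mul hε S P hPS hs, mul_assoc, div_mul_div_cancel₀ ha, div_self hb, mul_one]

end GL1

/-! ## §3 The finite correction `∏_{v∈P} c_v⁻¹` is holomorphic on `{−½ < re}` -/

/-- the denominator `(1−q^{−(2s+1)})(1−e·q^{−(2s+2)})` of `c_v⁻¹` does not vanish on `−½ < re s` when `‖e‖ ≤ 1`, `q > 1` (`‖q^{−z}‖ < 1` for `0 < re z`, as in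
★ `K2E1FiniteWhittakerInertU3.norm_natCast_cpow_neg_lt_one`, inlined to keep the import light). [folklore] -/
theorem localB_den_ne_zero {q : ℕ} (hq : 1 < q) {e : ℂ} (he : ‖e‖ ≤ 1) {s : ℂ} (hs : -(1 / 2 : ℝ) < s.re) :
    (1 - (q : ℂ) ^ (-(2 * s + 1))) * (1 - e * (q : ℂ) ^ (-(2 * s + 2))) ≠ 0 := by
  have key : ∀ z : ℂ, 0 < z.re → ‖(q : ℂ) ^ (-z)‖ < 1 := fun z hz => by
    rw [Complex.norm_natCast_cpow_of_pos (lt_trans zero_lt_one hq), Complex.neg_re]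
    exact Real.rpow_lt_one_of_one_lt_of_neg (by exact_mod_cast hq) (neg_lt_zero.2 hz)
  have h1 : ‖(q : ℂ) ^ (-(2 * s + 1))‖ < 1 := key _ (by simp [Complex.add_re, Complex.mul_re]; linarith)
  have h2 : ‖e * (q : ℂ) ^ (-(2 * s + 2))‖ < 1 := by
    rw [norm_mul]
    have h := key (2 * s + 2) (by simp [Complex.add_re, Complex.mul_re]; linarith)
    calc ‖e‖ * ‖(q : ℂ) ^ (-(2 * s + 2))‖ ≤ 1 * ‖(q : ℂ) ^ (-(2 * s + 2))‖ := by gcongr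
      _ < 1 := by rw [one_mul]; exact h
  refine mul_ne_zero (sub_ne_zero.2 ?_) (sub_ne_zero.2 ?_)
  · intro h; rw [← h, norm_one] at h1; exact lt_irrefl _ h1
  · intro h; rw [← h, norm_one] at h2; exact lt_irrefl _ h2

/-- `s ↦ q^{−(2s+r)}`-type maps are entire (`q ≠ 0`). [folklore] -/
theorem differentiable_natCast_cpow_neg_affine {q : ℕ} (hq : q ≠ 0) (r : ℂ) : Differentiable ℂ fun s : ℂ => (q : ℂ) ^ (-(2 * s + r)) :=
  Differentiable.const_cpow (((differentiable_id.const_mul _).add_const _).neg) (Or.inl (by exact_mod_cast hq))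

/-- **`c_v⁻¹ = b_v∕a_v` is holomorphic on `{−½ < re}`** (`q_v > 1`, `‖ε_v‖ ≤ 1`). [cite: KudlaSweet1997, §1] [cite: HarrisKudlaSweet1996, §6 (6.16)] -/
theorem differentiableOn_inv_localScalar {q : ℕ} (hq : 1 < q) {e : ℂ} (he : ‖e‖ ≤ 1) :
    DifferentiableOn ℂ (fun s : ℂ => ((1 - (q : ℂ) ^ (-(2 * s))) * (1 - e * (q : ℂ) ^ (-(2 * s - 1)))) /
      ((1 - (q : ℂ) ^ (-(2 * s + 1))) * (1 - e * (q : ℂ) ^ (-(2 * s + 2))))) {s : ℂ | -(1 / 2 : ℝ) < s.re} := by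
  have hq0 : q ≠ 0 := by omega
  have hnum : Differentiable ℂ fun s : ℂ => (1 - (q : ℂ) ^ (-(2 * s))) * (1 - e * (q : ℂ) ^ (-(2 * s - 1))) := by
    refine ((differentiable_const _).sub ?_).mul ((differentiable_const _).sub ((differentiable_const _).mul ?_))
    · simpa only [add_zero] using differentiable_natCast_cpow_neg_affine hq0 0
    · simpa only [sub_eq_add_neg] using differentiable_natCast_cpow_neg_affine hq0 (-1)
  have hden : Differentiable ℂ fun s : ℂ => (1 - (q : ℂ) ^ (-(2 * s + 1))) * (1 - e * (q : ℂ) ^ (-(2 * s + 2))) :=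
    ((differentiable_const _).sub (differentiable_natCast_cpow_neg_affine hq0 1)).mul
      ((differentiable_const _).sub ((differentiable_const _).mul (differentiable_natCast_cpow_neg_affine hq0 2)))
  exact hnum.differentiableOn.div hden.differentiableOn fun s hs => localB_den_ne_zero hq he hs

/-- hence **`∏_{v∈P} c_v⁻¹` is holomorphic on `{−½ < re}`** (and a fortiori on `{0 < re}`) for a unitary `ε`. [cite: KudlaSweet1997, §1] -/
theorem differentiableOn_finsetProd_inv_localScalar {F : Type} [Field F] [NumberField F] {ε : HeckeCharacter F} (hε : ε.IsUnitary)
    (P : Finset (HeightOneSpectrum (𝓞 F))) :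
    DifferentiableOn ℂ (fun s : ℂ => ∏ v ∈ P, (((1 - (v.residueCard : ℂ) ^ (-(2 * s))) * (1 - ε.valueAtUniformizer v * (v.residueCard : ℂ) ^ (-(2 * s - 1)))) /
        ((1 - (v.residueCard : ℂ) ^ (-(2 * s + 1))) * (1 - ε.valueAtUniformizer v * (v.residueCard : ℂ) ^ (-(2 * s + 2))))))
      {s : ℂ | -(1 / 2 : ℝ) < s.re} :=
  DifferentiableOn.fun_finsetProd fun v _ =>
    differentiableOn_inv_localScalar v.one_lt_residueCard (HeckeCharacter.norm_valueAtUniformizer_of_isUnitary hε v).le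

/-! ## §4 The CM corollaries: `ε = ε_{L∕L⁺}`, `F = L⁺` -/

section CM

variable (L : Type) [Field L] [NumberField L] [IsCMField L]

/-- **AT THE K2_Liu FRAME** (`ε = ε_{L∕L⁺}`, the parity character of every conjugate-symplectic `χ`): `b^S∕a^S = (∏_{v∈P} c_v⁻¹)·(b^{S∪P}∕a^{S∪P})` on `re s > 1` for any
set `S` of finite places of `L⁺` and any finite `P` disjoint from `S`. [cite: Tan1999, §3] [cite: Harris2007, (1.3.4) p. 92] -/
theorem invScalar_eq_finsetProd_mul_cm (S : Set (HeightOneSpectrum (𝓞 ↥(maximalRealSubfield L))))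
    (P : Finset (HeightOneSpectrum (𝓞 ↥(maximalRealSubfield L)))) (hPS : ∀ v ∈ P, v ∉ S) {s : ℂ} (hs : 1 < s.re) :
    (partialStandardL S (fun _ => {1}) (2 * s + 1) * partialStandardL S (fun v => {(quadraticHeckeCharCM L).valueAtUniformizer v}) (2 * s + 2)) /
        (partialStandardL S (fun _ => {1}) (2 * s) * partialStandardL S (fun v => {(quadraticHeckeCharCM L).valueAtUniformizer v}) (2 * s - 1)) =
      (∏ v ∈ P, (((1 - (v.residueCard : ℂ) ^ (-(2 * s))) * (1 - (quadraticHeckeCharCM L).valueAtUniformizer v * (v.residueCard : ℂ) ^ (-(2 * s - 1)))) /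
          ((1 - (v.residueCard : ℂ) ^ (-(2 * s + 1))) * (1 - (quadraticHeckeCharCM L).valueAtUniformizer v * (v.residueCard : ℂ) ^ (-(2 * s + 2)))))) *
        ((partialStandardL (S ∪ (↑P : Set (HeightOneSpectrum (𝓞 ↥(maximalRealSubfield L))))) (fun _ => {1}) (2 * s + 1) *
            partialStandardL (S ∪ (↑P : Set (HeightOneSpectrum (𝓞 ↥(maximalRealSubfield L))))) (fun v => {(quadraticHeckeCharCM L).valueAtUniformizer v}) (2 * s + 2)) /
          (partialStandardL (S ∪ (↑P : Set (HeightOneSpectrum (𝓞 ↥(maximalRealSubfield L))))) (fun _ => {1}) (2 * s) *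
            partialStandardL (S ∪ (↑P : Set (HeightOneSpectrum (𝓞 ↥(maximalRealSubfield L))))) (fun v => {(quadraticHeckeCharCM L).valueAtUniformizer v}) (2 * s - 1))) :=
  invScalar_eq_finsetProd_mul (Literature.RepresentationTheory.HarrisKudlaSweet1996.isFiniteOrder_quadraticHeckeCharCM (L := L)).isUnitary S P hPS hs

/-- **AT THE K2_Liu FRAME**: `∏_{v∈P} c_v⁻¹` is holomorphic on `{−½ < re}`. [cite: KudlaSweet1997, §1] -/
theorem differentiableOn_finsetProd_inv_localScalar_cm (P : Finset (HeightOneSpectrum (𝓞 ↥(maximalRealSubfield L)))) :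
    DifferentiableOn ℂ (fun s : ℂ => ∏ v ∈ P, (((1 - (v.residueCard : ℂ) ^ (-(2 * s))) * (1 - (quadraticHeckeCharCM L).valueAtUniformizer v * (v.residueCard : ℂ) ^ (-(2 * s - 1)))) /
        ((1 - (v.residueCard : ℂ) ^ (-(2 * s + 1))) * (1 - (quadraticHeckeCharCM L).valueAtUniformizer v * (v.residueCard : ℂ) ^ (-(2 * s + 2))))))
      {s : ℂ | -(1 / 2 : ℝ) < s.re} :=
  differentiableOn_finsetProd_inv_localScalar (Literature.RepresentationTheory.HarrisKudlaSweet1996.isFiniteOrder_quadraticHeckeCharCM (L := L)).isUnitary P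

end CM

end Summit.HodgeConjecture.HodgeConjecture.Cruxes.HLiu418.K2LiuSiegelIntertwiningScalarChangeOfSet

end
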